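import Summits.Ventures.CertifiedManyBodySolver.Downfold.EmeryOrbitalWeightFaceDirBox
import Summits.Ventures.CertifiedManyBodySolver.Downfold.EmeryVanHoveSubBox
import Summits.Ventures.CertifiedManyBodySolver.Downfold.EmeryVanHoveTableB
import Summits.Ventures.CertifiedManyBodySolver.Downfold.EmeryFermiFaceDirPointsTl1223OPK11NH114S1
import Summits.Ventures.CertifiedManyBodySolver.Downfold.EmeryFermiFaceDirPointsTl1223OPK11NH114S2
import Summits.Ventures.CertifiedManyBodySolver.Downfold.EmeryFermiFaceDirPointsTl1223OPK11NH114S3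
import HarnessLib

/-!
# THE ANTINODAL FERMI-SURFACE Cu-d WEIGHT OVER THE TYPED 3BE BOX `emeryBoxTl1223OPK11Src (EmeryBoxesKSlicesO)` AT FILLING n_H = 1.14 (ν = 43/100), regime-free rule v2 — the kinematic leg of the UPPER member
# `U_B∣full(w_antinode)` of the weak band-level `U` bracket read over a box where the v1 rule's antinodal charge-transfer regime FAILS at the low-Δ corners
# (INFL-3to1-B §B.90 (j); kernel `EmeryOrbitalWeightFaceDirBox`; router/EMERY-FS-WEIGHT-BRACKETS.tsv / OBJECT-E-BUDGET.tsv §C)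

Venture CertifiedManyBodySolver, cell `pub/hubbard-downfold` (stage S1), seat hubbard-downfold-mod-4 (technique B, g39); namespace
`Summit.Ventures.CertifiedManyBodySolver.Downfold.Emery`. Everything PROVED (0 sorry). WHAT THIS IS NOT: a statement about the material — the typed box (TlBa₂Ca₂Cu₃O₉ OUTER plane ((K) source box))
is SCREENING-GRADE; `U = 0` one-body kinematics of the σ model; the `U_B` arithmetic that consumes the window is DERIVED context on the MEAN-FIELD annex (R-B17).

For every member θ = (Δ, t_pd, t_pp, t_pp′) ∈ [1.47, 2.24] × [1.17, 1.38] × [0.61, 0.73] × [0.14, 0.18] eV at filling ν = 43/100, the Cu-d weight of the ANTINODAL Bloch state,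
`dWeightFace θ (fermiEnergyOf θ ν)`, lies in the window below. DEVICE (v2): `W(θ) = W(Δ/t_pd, 1, t_pp/t_pd, t_pp′/t_pd)` (scaling law); the t_pd range is cut into 3 slabs; on each
normalised slab the v2 CORNER RULE `dWeightFace_fermiEnergyOf_mem_Icc_of_mem_box3_dir_num`: Δ ↑ at fixed filling WITHOUT the regime (region-wide directional certificate
`faceDir_nonneg_of_mem_region`, κ₀ = 1/10, + the Fermi-energy slope law κ = 1/10 + mean value theorem), t_pp ↓, t_pp′ ↑ only at the upper corner (regime margin R2 there),
lower end `t_pp′`-decoupled (`dWeightFaceLoDec` at `E_h`); hole-likeness from the slab's `vhBoxCheck` + the Ψ table; two K = 384 Fermi-energy brackets per slab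
(`EmeryFermiFaceDirPointsTl1223OPK11NH114S<k>`). The slab corners are VIRTUAL (not members): the window is a sound ENCLOSURE (lower end ≈ 0.02 below the v1 virtual-corner value).

| t_pd slab (eV) | normalised slab Δ/t_pd × t_pp/t_pd × t_pp′/t_pd | q₁ (vhBoxCheck) ≥ table point | E_h | E_v | margins (R2, 1 − κ − w̄_axis) | **w_face window** |
|---|---|---|---|---|---|---|
| [1.17, 1.24] | [1.185, 1.915] × [0.4919, 0.6239] × [0.1129, 0.1538] | 0.5527 ≥ 27/50 (Ψ ≤ 0.3881) | 1.4832 | 1.1595 | +0.491, +0.136 | **[0.629, 0.7503]** |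
| [1.24, 1.31] | [1.122, 1.806] × [0.4656, 0.5887] × [0.1069, 0.1452] | 0.5318 ≥ 21/40 (Ψ ≤ 0.3899) | 1.5005 | 1.1899 | +0.553, +0.147 | **[0.6246, 0.7405]** |
| [1.31, 1.38] | [1.065, 1.71] × [0.442, 0.5573] × [0.1014, 0.1374] | 0.5120 ≥ 101/200 (Ψ ≤ 0.3925) | 1.5165 | 1.2183 | +0.610, +0.157 | **[0.6205, 0.7314]** |
| **whole box** | (hull of the slabs) | | | | | **[0.6205, 0.7503]** |

Sources: three-band model [HybertsenSchluterChristensen1989, Eq. (1)]; face point of the bilinear contour [AndersenEtAl1995, §6]; [folklore] algebra.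
-/

noncomputable section

namespace Summit.Ventures.CertifiedManyBodySolver.Downfold.Emery

open Real Set

/-- **Slab 1 (t_pd ∈ [1.17, 1.24] eV) of `emeryBoxTl1223OPK11Src (EmeryBoxesKSlicesO)`, ν = 43/100: the antinodal Fermi-surface Cu-d weight of every member lies in `[0.629, 0.7503]`**
(normalised-slab v2 corner rule; brackets `faceDirPt_Tl1223OPK11_nH114_s1_lo_br` / `_hi_br`). [folklore] -/
theorem tl1223OPK11Box_dWeightFaceDir_nH114_s1 {Δ a b c : ℝ} (hΔ : Δ ∈ Icc ((147 : ℝ) / 100) ((56 : ℝ) / 25)) (ha : a ∈ Icc ((117 : ℝ) / 100) ((31 : ℝ) / 25)) (hb : b ∈ Icc ((61 : ℝ) / 100) ((73 : ℝ) / 100)) (hc : c ∈ Icc ((7 : ℝ) / 50) ((9 : ℝ) / 50)) :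
    dWeightFace Δ a b c (fermiEnergyOf Δ a b c ((43 : ℝ) / 100)) ∈ Icc ((629 : ℝ) / 1000) ((7503 : ℝ) / 10000) := by
  have ha0 : 0 < a := lt_of_lt_of_le (by norm_num) ha.1
  rw [dWeightFace_fermiEnergyOf_eq_ratios ha0]
  have hΔn : Δ / a ∈ Icc ((147 : ℝ) / 124) ((224 : ℝ) / 117) := by
    constructor
    · rw [le_div_iff₀ ha0]; linarith [hΔ.1, ha.2]
    · rw [div_le_iff₀ ha0]; linarith [hΔ.2, ha.1]
  have hbn : b / a ∈ Icc ((61 : ℝ) / 124) ((73 : ℝ) / 117) := by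
    constructor
    · rw [le_div_iff₀ ha0]; linarith [hb.1, ha.2]
    · rw [div_le_iff₀ ha0]; linarith [hb.2, ha.1]
  have hcn : c / a ∈ Icc ((7 : ℝ) / 62) ((2 : ℝ) / 13) := by
    constructor
    · rw [le_div_iff₀ ha0]; linarith [hc.1, ha.2]
    · rw [div_le_iff₀ ha0]; linarith [hc.2, ha.1]
  have hVH : ∀ Δ' b' c' : ℝ, Δ' ∈ Icc ((147 : ℝ) / 124) ((224 : ℝ) / 117) → b' ∈ Icc ((61 : ℝ) / 124) ((73 : ℝ) / 117) → c' ∈ Icc ((7 : ℝ) / 62) ((2 : ℝ) / 13) →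
      1 - 2 * ((43 : ℝ) / 100) ≤ xVH Δ' 1 b' c' := by
    intro Δ' b' c' hΔ' hb' hc'
    have h := xVH_window_of_vhBoxCheck (Δ₁ := ((147 : ℚ) / 124)) (Δ₂ := ((224 : ℚ) / 117)) (a₁ := (1 : ℚ)) (a₂ := (1 : ℚ)) (b₁ := ((61 : ℚ) / 124)) (b₂ := ((73 : ℚ) / 117))
      (c₁ := ((7 : ℚ) / 62)) (c₂ := ((2 : ℚ) / 13)) (v₁ := ((5507 : ℚ) / 5000)) (v₂ := ((537 : ℚ) / 400)) (e := ((12929 : ℚ) / 10000)) (E := ((11407 : ℚ) / 10000))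
      (q₁ := ((5527 : ℚ) / 10000)) (q₂ := ((1277 : ℚ) / 1250)) (by decide +kernel)
      (Δ := Δ') (tpd := 1) (tpp := b') (c := c') (by simpa using hΔ') (by simp) (by simpa using hb') (by simpa using hc')
    obtain ⟨-, -, -, -, -, hwin⟩ := h
    push_cast at hwin
    have ht := vhFrac_27_50
    have hmono := vhFrac_anti (show (27 / 50 : ℝ) ≤ ((5527 : ℝ) / 10000) by norm_num)
    have hnu : ((57230 : ℝ) / 147456) ≤ ((43 : ℝ) / 100) := by norm_num
    linarith [hwin.1, ht.2]
  have hEh := (fermiEnergyOf_of_pointBracketCheck faceDirPt_Tl1223OPK11_nH114_s1_lo_br (by norm_num) (by norm_num) (by norm_num) (ν := (43/100 : ℝ))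
    (by push_cast; exact ⟨le_rfl, le_rfl⟩)).2
  have hEv := (fermiEnergyOf_of_pointBracketCheck faceDirPt_Tl1223OPK11_nH114_s1_hi_br (by norm_num) (by norm_num) (by norm_num) (ν := (43/100 : ℝ))
    (by push_cast; exact ⟨le_rfl, le_rfl⟩)).2
  push_cast at hEh hEv
  refine dWeightFace_fermiEnergyOf_mem_Icc_of_mem_box3_dir_num (Eh := ((927 : ℝ) / 625)) (Ev := ((2319 : ℝ) / 2000)) (Elow := ((2299 : ℝ) / 2000)) (κ₀ := 1 / 10) (κ := 1 / 10)
    (by norm_num) one_pos (by norm_num) (by norm_num) (by norm_num) hΔn hbn hcn (by norm_num) (by norm_num) hVH hEh.2 (by norm_num)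
    (by norm_num [faceU, fsD, fsN, cA]) (by norm_num [faceU, fsD, fsN, cA]) (by norm_num [faceU, fsD, fsN, cA]) (by norm_num [faceU, fsD, fsN, cA])
    hEv.1 (by norm_num) (by norm_num) (by norm_num [faceG]) (by norm_num) (by norm_num) (by norm_num) le_rfl (by norm_num [dWeightAxisCF])
    (by norm_num) (by norm_num) ?_ (by norm_num [dWeightFaceLoDec, faceRUp, faceN]) (by norm_num [dWeightFaceCF, faceN, faceR, fsN])
  intro D B C e hD hB hC he hG
  exact faceDir_nonneg_of_mem_region ⟨le_trans (by norm_num) hD.1, le_trans hD.2 (by norm_num)⟩ ⟨le_trans (by norm_num) he.1, le_trans he.2 (by norm_num)⟩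
    ⟨le_trans (by norm_num) hB.1, le_trans hB.2 (by norm_num)⟩ ⟨le_trans (by norm_num) hC.1, le_trans hC.2 (by norm_num)⟩ hG

/-- **Slab 2 (t_pd ∈ [1.24, 1.31] eV) of `emeryBoxTl1223OPK11Src (EmeryBoxesKSlicesO)`, ν = 43/100: the antinodal Fermi-surface Cu-d weight of every member lies in `[0.6246, 0.7405]`**
(normalised-slab v2 corner rule; brackets `faceDirPt_Tl1223OPK11_nH114_s2_lo_br` / `_hi_br`). [folklore] -/
theorem tl1223OPK11Box_dWeightFaceDir_nH114_s2 {Δ a b c : ℝ} (hΔ : Δ ∈ Icc ((147 : ℝ) / 100) ((56 : ℝ) / 25)) (ha : a ∈ Icc ((31 : ℝ) / 25) ((131 : ℝ) / 100)) (hb : b ∈ Icc ((61 : ℝ) / 100) ((73 : ℝ) / 100)) (hc : c ∈ Icc ((7 : ℝ) / 50) ((9 : ℝ) / 50)) :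
    dWeightFace Δ a b c (fermiEnergyOf Δ a b c ((43 : ℝ) / 100)) ∈ Icc ((3123 : ℝ) / 5000) ((1481 : ℝ) / 2000) := by
  have ha0 : 0 < a := lt_of_lt_of_le (by norm_num) ha.1
  rw [dWeightFace_fermiEnergyOf_eq_ratios ha0]
  have hΔn : Δ / a ∈ Icc ((147 : ℝ) / 131) ((56 : ℝ) / 31) := by
    constructor
    · rw [le_div_iff₀ ha0]; linarith [hΔ.1, ha.2]
    · rw [div_le_iff₀ ha0]; linarith [hΔ.2, ha.1]
  have hbn : b / a ∈ Icc ((61 : ℝ) / 131) ((73 : ℝ) / 124) := by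
    constructor
    · rw [le_div_iff₀ ha0]; linarith [hb.1, ha.2]
    · rw [div_le_iff₀ ha0]; linarith [hb.2, ha.1]
  have hcn : c / a ∈ Icc ((14 : ℝ) / 131) ((9 : ℝ) / 62) := by
    constructor
    · rw [le_div_iff₀ ha0]; linarith [hc.1, ha.2]
    · rw [div_le_iff₀ ha0]; linarith [hc.2, ha.1]
  have hVH : ∀ Δ' b' c' : ℝ, Δ' ∈ Icc ((147 : ℝ) / 131) ((56 : ℝ) / 31) → b' ∈ Icc ((61 : ℝ) / 131) ((73 : ℝ) / 124) → c' ∈ Icc ((14 : ℝ) / 131) ((9 : ℝ) / 62) →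
      1 - 2 * ((43 : ℝ) / 100) ≤ xVH Δ' 1 b' c' := by
    intro Δ' b' c' hΔ' hb' hc'
    have h := xVH_window_of_vhBoxCheck (Δ₁ := ((147 : ℚ) / 131)) (Δ₂ := ((56 : ℚ) / 31)) (a₁ := (1 : ℚ)) (a₂ := (1 : ℚ)) (b₁ := ((61 : ℚ) / 131)) (b₂ := ((73 : ℚ) / 124))
      (c₁ := ((14 : ℚ) / 131)) (c₂ := ((9 : ℚ) / 62)) (v₁ := ((2271 : ℚ) / 2000)) (v₂ := ((13701 : ℚ) / 10000)) (e := ((6611 : ℚ) / 5000)) (E := ((11739 : ℚ) / 10000))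
      (q₁ := ((2659 : ℚ) / 5000)) (q₂ := ((9611 : ℚ) / 10000)) (by decide +kernel)
      (Δ := Δ') (tpd := 1) (tpp := b') (c := c') (by simpa using hΔ') (by simp) (by simpa using hb') (by simpa using hc')
    obtain ⟨-, -, -, -, -, hwin⟩ := h
    push_cast at hwin
    have ht := vhFrac_21_40
    have hmono := vhFrac_anti (show (21 / 40 : ℝ) ≤ ((2659 : ℝ) / 5000) by norm_num)
    have hnu : ((57496 : ℝ) / 147456) ≤ ((43 : ℝ) / 100) := by norm_num
    linarith [hwin.1, ht.2]
  have hEh := (fermiEnergyOf_of_pointBracketCheck faceDirPt_Tl1223OPK11_nH114_s2_lo_br (by norm_num) (by norm_num) (by norm_num) (ν := (43/100 : ℝ))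
    (by push_cast; exact ⟨le_rfl, le_rfl⟩)).2
  have hEv := (fermiEnergyOf_of_pointBracketCheck faceDirPt_Tl1223OPK11_nH114_s2_hi_br (by norm_num) (by norm_num) (by norm_num) (ν := (43/100 : ℝ))
    (by push_cast; exact ⟨le_rfl, le_rfl⟩)).2
  push_cast at hEh hEv
  refine dWeightFace_fermiEnergyOf_mem_Icc_of_mem_box3_dir_num (Eh := ((3001 : ℝ) / 2000)) (Ev := ((11899 : ℝ) / 10000)) (Elow := ((11799 : ℝ) / 10000)) (κ₀ := 1 / 10) (κ := 1 / 10)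
    (by norm_num) one_pos (by norm_num) (by norm_num) (by norm_num) hΔn hbn hcn (by norm_num) (by norm_num) hVH hEh.2 (by norm_num)
    (by norm_num [faceU, fsD, fsN, cA]) (by norm_num [faceU, fsD, fsN, cA]) (by norm_num [faceU, fsD, fsN, cA]) (by norm_num [faceU, fsD, fsN, cA])
    hEv.1 (by norm_num) (by norm_num) (by norm_num [faceG]) (by norm_num) (by norm_num) (by norm_num) le_rfl (by norm_num [dWeightAxisCF])
    (by norm_num) (by norm_num) ?_ (by norm_num [dWeightFaceLoDec, faceRUp, faceN]) (by norm_num [dWeightFaceCF, faceN, faceR, fsN])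
  intro D B C e hD hB hC he hG
  exact faceDir_nonneg_of_mem_region ⟨le_trans (by norm_num) hD.1, le_trans hD.2 (by norm_num)⟩ ⟨le_trans (by norm_num) he.1, le_trans he.2 (by norm_num)⟩
    ⟨le_trans (by norm_num) hB.1, le_trans hB.2 (by norm_num)⟩ ⟨le_trans (by norm_num) hC.1, le_trans hC.2 (by norm_num)⟩ hG

/-- **Slab 3 (t_pd ∈ [1.31, 1.38] eV) of `emeryBoxTl1223OPK11Src (EmeryBoxesKSlicesO)`, ν = 43/100: the antinodal Fermi-surface Cu-d weight of every member lies in `[0.6205, 0.7314]`**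
(normalised-slab v2 corner rule; brackets `faceDirPt_Tl1223OPK11_nH114_s3_lo_br` / `_hi_br`). [folklore] -/
theorem tl1223OPK11Box_dWeightFaceDir_nH114_s3 {Δ a b c : ℝ} (hΔ : Δ ∈ Icc ((147 : ℝ) / 100) ((56 : ℝ) / 25)) (ha : a ∈ Icc ((131 : ℝ) / 100) ((69 : ℝ) / 50)) (hb : b ∈ Icc ((61 : ℝ) / 100) ((73 : ℝ) / 100)) (hc : c ∈ Icc ((7 : ℝ) / 50) ((9 : ℝ) / 50)) :
    dWeightFace Δ a b c (fermiEnergyOf Δ a b c ((43 : ℝ) / 100)) ∈ Icc ((1241 : ℝ) / 2000) ((3657 : ℝ) / 5000) := by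
  have ha0 : 0 < a := lt_of_lt_of_le (by norm_num) ha.1
  rw [dWeightFace_fermiEnergyOf_eq_ratios ha0]
  have hΔn : Δ / a ∈ Icc ((49 : ℝ) / 46) ((224 : ℝ) / 131) := by
    constructor
    · rw [le_div_iff₀ ha0]; linarith [hΔ.1, ha.2]
    · rw [div_le_iff₀ ha0]; linarith [hΔ.2, ha.1]
  have hbn : b / a ∈ Icc ((61 : ℝ) / 138) ((73 : ℝ) / 131) := by
    constructor
    · rw [le_div_iff₀ ha0]; linarith [hb.1, ha.2]
    · rw [div_le_iff₀ ha0]; linarith [hb.2, ha.1]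
  have hcn : c / a ∈ Icc ((7 : ℝ) / 69) ((18 : ℝ) / 131) := by
    constructor
    · rw [le_div_iff₀ ha0]; linarith [hc.1, ha.2]
    · rw [div_le_iff₀ ha0]; linarith [hc.2, ha.1]
  have hVH : ∀ Δ' b' c' : ℝ, Δ' ∈ Icc ((49 : ℝ) / 46) ((224 : ℝ) / 131) → b' ∈ Icc ((61 : ℝ) / 138) ((73 : ℝ) / 131) → c' ∈ Icc ((7 : ℝ) / 69) ((18 : ℝ) / 131) →
      1 - 2 * ((43 : ℝ) / 100) ≤ xVH Δ' 1 b' c' := by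
    intro Δ' b' c' hΔ' hb' hc'
    have h := xVH_window_of_vhBoxCheck (Δ₁ := ((49 : ℚ) / 46)) (Δ₂ := ((224 : ℚ) / 131)) (a₁ := (1 : ℚ)) (a₂ := (1 : ℚ)) (b₁ := ((61 : ℚ) / 138)) (b₂ := ((73 : ℚ) / 131))
      (c₁ := ((7 : ℚ) / 69)) (c₂ := ((18 : ℚ) / 131)) (v₁ := ((1459 : ℚ) / 1250)) (v₂ := ((2791 : ℚ) / 2000)) (e := ((6747 : ℚ) / 5000)) (E := ((12047 : ℚ) / 10000))
      (q₁ := ((64 : ℚ) / 125)) (q₂ := ((1813 : ℚ) / 2000)) (by decide +kernel)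
      (Δ := Δ') (tpd := 1) (tpp := b') (c := c') (by simpa using hΔ') (by simp) (by simpa using hb') (by simpa using hc')
    obtain ⟨-, -, -, -, -, hwin⟩ := h
    push_cast at hwin
    have ht := vhFrac_101_200
    have hmono := vhFrac_anti (show (101 / 200 : ℝ) ≤ ((64 : ℝ) / 125) by norm_num)
    have hnu : ((57877 : ℝ) / 147456) ≤ ((43 : ℝ) / 100) := by norm_num
    linarith [hwin.1, ht.2]
  have hEh := (fermiEnergyOf_of_pointBracketCheck faceDirPt_Tl1223OPK11_nH114_s3_lo_br (by norm_num) (by norm_num) (by norm_num) (ν := (43/100 : ℝ))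
    (by push_cast; exact ⟨le_rfl, le_rfl⟩)).2
  have hEv := (fermiEnergyOf_of_pointBracketCheck faceDirPt_Tl1223OPK11_nH114_s3_hi_br (by norm_num) (by norm_num) (by norm_num) (ν := (43/100 : ℝ))
    (by push_cast; exact ⟨le_rfl, le_rfl⟩)).2
  push_cast at hEh hEv
  refine dWeightFace_fermiEnergyOf_mem_Icc_of_mem_box3_dir_num (Eh := ((3033 : ℝ) / 2000)) (Ev := ((12183 : ℝ) / 10000)) (Elow := ((12083 : ℝ) / 10000)) (κ₀ := 1 / 10) (κ := 1 / 10)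
    (by norm_num) one_pos (by norm_num) (by norm_num) (by norm_num) hΔn hbn hcn (by norm_num) (by norm_num) hVH hEh.2 (by norm_num)
    (by norm_num [faceU, fsD, fsN, cA]) (by norm_num [faceU, fsD, fsN, cA]) (by norm_num [faceU, fsD, fsN, cA]) (by norm_num [faceU, fsD, fsN, cA])
    hEv.1 (by norm_num) (by norm_num) (by norm_num [faceG]) (by norm_num) (by norm_num) (by norm_num) le_rfl (by norm_num [dWeightAxisCF])
    (by norm_num) (by norm_num) ?_ (by norm_num [dWeightFaceLoDec, faceRUp, faceN]) (by norm_num [dWeightFaceCF, faceN, faceR, fsN])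
  intro D B C e hD hB hC he hG
  exact faceDir_nonneg_of_mem_region ⟨le_trans (by norm_num) hD.1, le_trans hD.2 (by norm_num)⟩ ⟨le_trans (by norm_num) he.1, le_trans he.2 (by norm_num)⟩
    ⟨le_trans (by norm_num) hB.1, le_trans hB.2 (by norm_num)⟩ ⟨le_trans (by norm_num) hC.1, le_trans hC.2 (by norm_num)⟩ hG

/-- **`emeryBoxTl1223OPK11Src (EmeryBoxesKSlicesO)`, ν = 43/100: for EVERY member θ the Cu-d weight of the antinodal Fermi-surface state lies in `[0.6205, 0.7503]`** (hull of the 3 t_pd slab windows; regime-free rule v2). [folklore] -/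
theorem tl1223OPK11Box_dWeightFaceDir_nH114 {Δ a b c : ℝ} (hΔ : Δ ∈ Icc ((147 : ℝ) / 100) ((56 : ℝ) / 25)) (ha : a ∈ Icc ((117 : ℝ) / 100) ((69 : ℝ) / 50)) (hb : b ∈ Icc ((61 : ℝ) / 100) ((73 : ℝ) / 100)) (hc : c ∈ Icc ((7 : ℝ) / 50) ((9 : ℝ) / 50)) :
    dWeightFace Δ a b c (fermiEnergyOf Δ a b c ((43 : ℝ) / 100)) ∈ Icc ((1241 : ℝ) / 2000) ((7503 : ℝ) / 10000) := by
  rcases le_or_gt a ((31 : ℝ) / 25) with h1 | h1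
  · have h := tl1223OPK11Box_dWeightFaceDir_nH114_s1 hΔ ⟨ha.1, h1⟩ hb hc
    exact ⟨le_trans (by norm_num) h.1, le_trans h.2 (by norm_num)⟩
  · rcases le_or_gt a ((131 : ℝ) / 100) with h2 | h2
    · have h := tl1223OPK11Box_dWeightFaceDir_nH114_s2 hΔ ⟨h1.le, h2⟩ hb hc
      exact ⟨le_trans (by norm_num) h.1, le_trans h.2 (by norm_num)⟩
    · have h := tl1223OPK11Box_dWeightFaceDir_nH114_s3 hΔ ⟨h2.le, ha.2⟩ hb hc
      exact ⟨le_trans (by norm_num) h.1, le_trans h.2 (by norm_num)⟩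

end Summit.Ventures.CertifiedManyBodySolver.Downfold.Emery
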